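import Summits.QuantumFields.BalabanUV.Beta.GAN24.T2HybridCells
import Summits.QuantumFields.BalabanUV.Beta.GAN24.T2RecHybridSplit
import Summits.QuantumFields.BalabanUV.Beta.GAN24.LinT2CoDressedStep
import Summits.QuantumFields.BalabanUV.Beta.GAN24.WSlotFirstDiff

/-!
# `BalabanUV.Beta.GAN24.T2HybridCellsComb` — binder row G-an2-4 / (CONV-C), W-slot CT-W ((R-HYB) + (R-CT)): **THE DRESSING CELLS OF THE COMB `T₂` TOWER** —
# `cell_l = 𝒜^B_l((𝔇 − 1) T̃_l)` (ONE undressed step applied to the dressing defect of the member), and the comb tower unrolled through road «W3»'s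
# UNDRESSED transport OF RECORD with sources «dressed source + cell» (one level sum) ∕ as p2's hybrid carrier plus the level sum of transported cells (two)

NOT IN PRINT; OUR BOOKKEEPING ([folklore] instantiation of `T2HybridCells` §1 at an2's slotted ∕ comb `T₂` family over gan24-p2 g35's (F1)∕(R-HYB) letters
(`T2RecOfUnitSplit`, `T2RecHybridSplit`) and leaf-06 g42's `LinT2CoDressedStep.lin4_comb_coDressKBmAt`; G-an2-4 formalisation swarm, leaf prover
`b2b-balaban-gan24-formalise-leaf-01`, gen 62; OFFER O-leaf01-g62-1, journal l.37593 ∕ l.37750; name PROVISIONAL).  HONEST FRAMING (cell contract, verbatim):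
«discharging `BetaPertH` makes Bałaban's UV stability UNCONDITIONAL — a real constructive-QFT result; it is NOT the continuum limit and NOT the Clay problem.»
HONEST DEPENDENCY (verbatim): «continuum YM on T⁴ ⇐ BetaPertH ∧ nine spine estimates (0/9 proved); BetaPertH ⇐ (D1) ∧ (D4) ∧ CAP+tail; G-an2-4 gates asym, D1 and NE2/3/4.»

## What (generic `d`; in-block root `ρ = toSite r`, `r ∈ box (d+1) Lc`; `T̃_j = unitS₂_j (T2RecAt d Lc ρ … j)`, `Ĝ_j = coDressKBmAt ρ Lc (KInvStep Lc j)`, `K_j = KInvStep Lc j`,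
## `c₄ = cE₂·Lc^{2(d+1)}`, `𝔇X κ u κ′ u′ := dressKBmAt ρ Lc (coProjBmAtK ρ Lc (κ₁ u₁ ↦ coProjBmAtK ρ Lc (X κ₁ u₁) κ′ u′) κ u)` — leaf-06's leg-and-slot dressing)
* §1 `exists_locStencil₂_unitS₂_T2RecAt` (every normalised comb member is a `LocStencil₂` family — an2's `T2RecAt_loc_of_slot` + leaf-08's `locStencil₂_unitS₂`);
  `bdd₄_dressTab` (the dressed table of a `LocStencil₂` table has bounded entries — leaf-06's `locStencil₂_coProj_snd ∕ _fst ∕ _dress`).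
* §2 **`cell_comb_eq`** — `lin4 c (unitK_l Ĝ_l) Lc T̃_l − lin4 c (unitK_l K_l) Lc T̃_l = lin4 c (unitK_l K_l) Lc (𝔇T̃_l − T̃_l)`: the dressing cell of the comb tower IS road W3's
  UNDRESSED step on the member's dressing DEFECT.  Hence (with leaf-02's exact one-step charge law `Lin4ZeroMode.zmode_one_lin4_step`) the `Zfree` row of a cell reads
  «`𝔇` preserves the bond-symmetrised cell charge of `T̃_l`», and its envelope row is ONE undressed step (`TransportMarginal.step_shape`) on the envelope of
  `(𝔇 − 1)T̃_l` — to be read off the slot-divergence identities of `T̃_l`, NOT off `T̃_l`'s own envelope ((R-CT), OPEN; located remark R-leaf01-g62-1).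
* §3 (slotted family, (F1)'s letters, ANY second kernel family `K` decaying per level): `succ_eq_lin4_add_of_letters` (the affine step, letters discharged per level);
  **`unitS₂_T2RecOf_eq_transportB_add_sum_cell_of_letters`** — `T̃_n = 𝒯^B(0,n) T̃_0 + Σ_{l<n} 𝒯^B(l+1,n−1−l) (b̃_l + cell_l)`: road W3's END binder `hsplit` VERBATIM for
  the DRESSED tower, with the transport OF RECORD and the sources `b̃_l + cell_l`; **`unitS₂_T2RecOf_eq_hyb_add_sum_transport_cell_of_letters`** — the two-sum form
  `T̃_n = T^{hyb}_n + Σ_{l<n} 𝒯^B(l+1,n−1−l) cell_l`.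
* §4 the COMB data, letters discharged (asym1 ∕ an2 ∕ an1 exactly as in p2's `T2RecHybridSplit` §4): **`unitS₂_T2RecAt_eq_transportB_add_sum_cell`**,
  **`unitS₂_T2RecAt_eq_hyb_add_sum_transport_cell`**.
Asserts NO shape of Bałaban's tables; discharges NOTHING of «T2Shape» ∕ «T2Drift» ∕ (hW, hWall); NOT «W-slot closed», NEVER «G-an2-4 closed» as (CONV-C); NOT D1,
NOT `BetaPertH`, NOT continuum, NOT Clay.  0 cited facts, 0 `def`, 0 `def … : Prop`, 0 sorry.
-/

noncomputable section

open Finset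
open scoped BigOperators
open Literature.MathematicalPhysics.QuantumFieldTheory
open Literature.MathematicalPhysics.QuantumFieldTheory.Balaban1983to89
open Literature.MathematicalPhysics.QuantumFieldTheory.Balaban1983to89.Beta
open ExpKernelCalculus (MKer Decays BiLoc VertexFamily VertexFamily₂)
open OneStepResolventKernel (Fib LocStencil decays_mono)
open OneStepKernelFamily (KInvStep decays_KInvStep)
open AffineAveraging (box toSite)
open AveragingMixedJetTables (mixFFAt)
open SecondOrderResponse (W2SymOfK LocStencilFM)
open BalabanCompositeJets (LocStencil₂)
open BalabanStepJetsSucc (mmRead)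
open BalabanStepW2 (K3OfK M2Of)
open Summit.QuantumFields.BalabanUV.Beta.HessKerDressedUnits (unitK unitS decays_unitK)
open Summit.QuantumFields.BalabanUV.Beta.SecondOrderUnits (unitM unitS₂ unitM₂)
open Summit.QuantumFields.BalabanUV.Beta.AxialDressingRooted (coDressKBmAt dressKBmAt coProjBmAtK decays_coDressKBmAt_KInvStep)
open Summit.QuantumFields.BalabanUV.Beta.SpineRooted (T2RecOf T2RecAt SpureRecAt M1At T2RecOf_comb locStencil_SpureRecAt vertexFamily_M1At T2RecAt_loc_of_slot)
open Summit.QuantumFields.BalabanUV.Beta.MixedJetTablesPlug (hmix_an1)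
open Summit.QuantumFields.BalabanUV.Beta.GAN24.CombesThomas (sfStep smStep sfStep_ne_zero smStep_ne_zero)
open Summit.QuantumFields.BalabanUV.Beta.GAN24.T2RecursionAffine (lin4)
open Summit.QuantumFields.BalabanUV.Beta.GAN24.AffineUnroll (transport)
open Summit.QuantumFields.BalabanUV.Beta.GAN24.Lin4Additive (lin4_bdd)
open Summit.QuantumFields.BalabanUV.Beta.GAN24.T2UnitSplitLevels (bdd₄_zero bdd₄_add bdd₄_sub lin4_add_of_bdd₄)
open Summit.QuantumFields.BalabanUV.Beta.GAN24.T2UnitSplitShapes (bdd₄_of_locStencil₂)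
open Summit.QuantumFields.BalabanUV.Beta.GAN24.T2RecOfUnitSplit (unitS₂_T2RecOf_succ_eq_lin4_add step_data_of_letters bdd₄_unitS₂_T2RecOf_of_letters)
open Summit.QuantumFields.BalabanUV.Beta.GAN24.T2RecHybridSplit (bdd₄_source_of_letters)
open Summit.QuantumFields.BalabanUV.Beta.GAN24.LinT2CoDressed (locStencil₂_coProj_snd locStencil₂_coProj_fst locStencil₂_dress)
open Summit.QuantumFields.BalabanUV.Beta.GAN24.LinT2CoDressedStep (lin4_comb_coDressKBmAt)
open Summit.QuantumFields.BalabanUV.Beta.GAN24.WSlotFirstDiff (locStencil₂_unitS₂)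
open Summit.QuantumFields.BalabanUV.Beta.GAN24.T2HybridCells (eq_transportB_add_sum_cell eq_hyb_add_sum_transport_cell)

namespace Summit.QuantumFields.BalabanUV.Beta.GAN24.T2HybridCellsComb

variable {d : ℕ}

/-! ## §1 Envelopes: the normalised comb members and their dressed tables are bounded -/

section Envelopes

variable {Lc : ℕ} [NeZero Lc] {r : Fin (d + 1) → ℕ}

/-- [folklore] **EVERY NORMALISED COMB MEMBER IS A `LocStencil₂` FAMILY** (some constant, some rate `δ > 0`, per level): an2's `T2RecAt_loc_of_slot` (mixed-table letter
discharged by an1's `hmix_an1`) + leaf-08's `WSlotFirstDiff.locStencil₂_unitS₂`. -/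
theorem exists_locStencil₂_unitS₂_T2RecAt (hLc : 1 ≤ Lc) (hr : r ∈ box (d + 1) Lc) (cE cVH cΛ cE₂ cB : ℝ) (Tc : Fin 4 → Fin 4 → Fin 4 → Fin 4 → ℝ)
    {vh₂S : Fin (d + 1) → (Fin (d + 1) → ℤ) → Fin (d + 1) → (Fin (d + 1) → ℤ) → MKer (d + 1) (Fib d)}
    (hB : ∃ C δ : ℝ, 0 < δ ∧ LocStencil₂ vh₂S C δ) (j : ℕ) :
    ∃ C δ : ℝ, 0 < δ ∧ LocStencil₂ (unitS₂ (sfStep Lc j) (smStep d Lc j)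
      (T2RecAt d Lc (toSite r) cE cVH cΛ cE₂ cB Tc vh₂S (mixFFAt (toSite r) Lc) j)) C δ := by
  obtain ⟨C, δ, hδ, h⟩ := T2RecAt_loc_of_slot (cE := cE) (cVH := cVH) (cΛ := cΛ) (cE₂ := cE₂) (cB := cB) (T := Tc) (vh₂S := vh₂S)
    (mixFF := mixFFAt (toSite r) Lc) hLc hr hB (hmix_an1 hLc hr) j
  exact ⟨_, δ, hδ, locStencil₂_unitS₂ _ _ h⟩

omit [NeZero Lc] in
/-- [folklore] **THE DRESSED TABLE OF A `LocStencil₂` TABLE HAS BOUNDED ENTRIES** (leaf-06 g42's `locStencil₂_coProj_snd` → `_coProj_fst` → `_dress`, then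
leaf-01's `bdd₄_of_locStencil₂`). -/
theorem bdd₄_dressTab (hLc : 1 ≤ Lc) (hr : r ∈ box (d + 1) Lc)
    {X : Fin (d + 1) → (Fin (d + 1) → ℤ) → Fin (d + 1) → (Fin (d + 1) → ℤ) → MKer (d + 1) (Fib d)} {C δ : ℝ}
    (hX : LocStencil₂ X C δ) (hδ : 0 ≤ δ) :
    ∃ B : ℝ, ∀ κ u κ' u' x z a b, |(fun κ u κ' u' => dressKBmAt (toSite r) Lc
      (coProjBmAtK (toSite r) Lc (fun κ₁ u₁ => coProjBmAtK (toSite r) Lc (X κ₁ u₁) κ' u') κ u)) κ u κ' u' x z a b| ≤ B :=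
  bdd₄_of_locStencil₂ (locStencil₂_dress hLc hr (locStencil₂_coProj_fst hLc hr (locStencil₂_coProj_snd hLc hr hX hδ) hδ) hδ) hδ

end Envelopes

/-! ## §2 The comb cell is ONE undressed step applied to the dressing defect of the member -/

section Cell

variable {Lc : ℕ} [NeZero Lc] {r : Fin (d + 1) → ℕ}

/-- NOT IN PRINT; OUR BOOKKEEPING ([folklore] leaf-06 g42's `lin4_comb_coDressKBmAt` + `lin4_add_of_bdd₄`).  **THE DRESSING CELL OF THE COMB TOWER**: for every level `l`,
every `(cE, cVH, cΛ, cE₂, cB)`, every initial table, every `LocStencil₂` border and every `c`,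
`lin4 c (unitK_l Ĝ_l) Lc T̃_l − lin4 c (unitK_l K_l) Lc T̃_l = lin4 c (unitK_l K_l) Lc (𝔇T̃_l − T̃_l)` — the dressed-minus-undressed one-step map on the member equals road W3's
UNDRESSED one-step map on the member's dressing DEFECT `(𝔇 − 1)T̃_l`. -/
theorem cell_comb_eq (hr : r ∈ box (d + 1) Lc) (cE cVH cΛ cE₂ cB : ℝ) (Tc : Fin 4 → Fin 4 → Fin 4 → Fin 4 → ℝ)
    {vh₂S : Fin (d + 1) → (Fin (d + 1) → ℤ) → Fin (d + 1) → (Fin (d + 1) → ℤ) → MKer (d + 1) (Fib d)}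
    (hB : ∃ C δ : ℝ, 0 < δ ∧ LocStencil₂ vh₂S C δ) (c : ℝ) (l : ℕ) :
    lin4 c (unitK (sfStep Lc l) (smStep d Lc l) (coDressKBmAt (toSite r) Lc (KInvStep (d := d) Lc l))) Lc
        (unitS₂ (sfStep Lc l) (smStep d Lc l) (T2RecAt d Lc (toSite r) cE cVH cΛ cE₂ cB Tc vh₂S (mixFFAt (toSite r) Lc) l)) -
      lin4 c (unitK (sfStep Lc l) (smStep d Lc l) (KInvStep (d := d) Lc l)) Lc
        (unitS₂ (sfStep Lc l) (smStep d Lc l) (T2RecAt d Lc (toSite r) cE cVH cΛ cE₂ cB Tc vh₂S (mixFFAt (toSite r) Lc) l)) =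
      lin4 c (unitK (sfStep Lc l) (smStep d Lc l) (KInvStep (d := d) Lc l)) Lc
        ((fun κ u κ' u' => dressKBmAt (toSite r) Lc (coProjBmAtK (toSite r) Lc (fun κ₁ u₁ => coProjBmAtK (toSite r) Lc
            (unitS₂ (sfStep Lc l) (smStep d Lc l) (T2RecAt d Lc (toSite r) cE cVH cΛ cE₂ cB Tc vh₂S (mixFFAt (toSite r) Lc) l) κ₁ u₁) κ' u') κ u)) -
          unitS₂ (sfStep Lc l) (smStep d Lc l) (T2RecAt d Lc (toSite r) cE cVH cΛ cE₂ cB Tc vh₂S (mixFFAt (toSite r) Lc) l)) := by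
  have hLc : 1 ≤ Lc := Nat.one_le_iff_ne_zero.mpr (NeZero.ne Lc)
  obtain ⟨CX, δX, hδX, hX⟩ := exists_locStencil₂_unitS₂_T2RecAt hLc hr cE cVH cΛ cE₂ cB Tc hB l
  rw [lin4_comb_coDressKBmAt hr l hX hδX c]
  obtain ⟨δK, CK, hδK, -, hK⟩ := decays_KInvStep (d := d) (Lc := Lc) l
  have hKu := decays_unitK (sf := sfStep Lc l) (sm := smStep d Lc l) hK
  have hT := bdd₄_of_locStencil₂ hX hδX.le
  have hD := bdd₄_dressTab (r := r) hLc hr hX hδX.le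
  obtain ⟨D, hDdef⟩ : ∃ D : Fin (d + 1) → (Fin (d + 1) → ℤ) → Fin (d + 1) → (Fin (d + 1) → ℤ) → MKer (d + 1) (Fib d),
      D = fun κ u κ' u' => dressKBmAt (toSite r) Lc (coProjBmAtK (toSite r) Lc (fun κ₁ u₁ => coProjBmAtK (toSite r) Lc
        (unitS₂ (sfStep Lc l) (smStep d Lc l) (T2RecAt d Lc (toSite r) cE cVH cΛ cE₂ cB Tc vh₂S (mixFFAt (toSite r) Lc) l) κ₁ u₁) κ' u') κ u) := ⟨_, rfl⟩
  rw [← hDdef] at hD ⊢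
  have e : D = (D - unitS₂ (sfStep Lc l) (smStep d Lc l) (T2RecAt d Lc (toSite r) cE cVH cΛ cE₂ cB Tc vh₂S (mixFFAt (toSite r) Lc) l)) +
      unitS₂ (sfStep Lc l) (smStep d Lc l) (T2RecAt d Lc (toSite r) cE cVH cΛ cE₂ cB Tc vh₂S (mixFFAt (toSite r) Lc) l) := by
    rw [sub_add_cancel]
  conv_lhs => rw [e]
  rw [lin4_add_of_bdd₄ hKu hδK c Lc (bdd₄_sub hD hT) hT]
  abel

end Cell

/-! ## §3 The slotted tower through the UNDRESSED transport: sources «dressed source + cell» (one sum) ∕ hybrid carrier + transported cells (two sums) -/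

section Slotted

variable {Lc : ℕ} [NeZero Lc] (G K : ℕ → MKer (d + 1) (Fib d)) (S M : ℕ → Fin (d + 1) → (Fin (d + 1) → ℤ) → MKer (d + 1) (Fib d)) (cE₂ cB : ℝ)
  (Tc : Fin 4 → Fin 4 → Fin 4 → Fin 4 → ℝ)
  {vh₂S mixFF : Fin (d + 1) → (Fin (d + 1) → ℤ) → Fin (d + 1) → (Fin (d + 1) → ℤ) → MKer (d + 1) (Fib d)}

/-- [folklore] **THE AFFINE STEP FROM THE LETTERS**, every level: `T̃_{j+1} = lin4 c₄ G̃_j Lc T̃_j + b̃_j` ((F1)'s `unitS₂_T2RecOf_succ_eq_lin4_add` with its per-level step data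
DISCHARGED by `step_data_of_letters`). -/
theorem succ_eq_lin4_add_of_letters (hLc : 1 ≤ Lc)
    (hBff : ∀ κ u κ' u' x z (α β : Fin (d + 1)), vh₂S κ u κ' u' x z (Sum.inl α) (Sum.inl β) = 0)
    (hBmm : ∀ κ u κ' u' x z (μ ν : Fin (d + 1)), vh₂S κ u κ' u' x z (Sum.inr μ) (Sum.inr ν) = 0)
    (hG : ∀ j : ℕ, ∃ δ C : ℝ, 0 < δ ∧ 0 ≤ C ∧ Decays (G j) C δ)
    (hS : ∀ j : ℕ, ∃ Cs δ : ℝ, 0 < δ ∧ LocStencil (S j) Cs δ) (hM : ∀ j : ℕ, ∃ CM δ : ℝ, 0 < δ ∧ VertexFamily (M j) Lc CM δ)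
    (hBl : ∃ C δ : ℝ, 0 < δ ∧ LocStencil₂ vh₂S C δ) (hmix : ∃ C δ : ℝ, 0 < δ ∧ LocStencilFM Lc mixFF C δ) (j : ℕ) :
    (unitS₂ (sfStep Lc (j + 1)) (smStep d Lc (j + 1)) (T2RecOf d Lc G S M cE₂ cB Tc vh₂S mixFF (j + 1))) =
      (fun j => lin4 (cE₂ * (Lc : ℝ) ^ (2 * (d + 1))) (unitK (sfStep Lc j) (smStep d Lc j) (G j)) Lc) j
        (unitS₂ (sfStep Lc j) (smStep d Lc j) (T2RecOf d Lc G S M cE₂ cB Tc vh₂S mixFF j)) +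
      (fun κ u κ' u' => (cE₂ * (Lc : ℝ) ^ (2 * (d + 1))) • mmRead Lc (K3OfK (unitK (sfStep Lc j) (smStep d Lc j) (G j)) Lc
            (unitS (sfStep Lc j) (smStep d Lc j) (S j)) (unitM (sfStep Lc j) (smStep d Lc j) (M j)) (W2SymOfK
            (unitK (sfStep Lc j) (smStep d Lc j) (G j)) Lc (unitS (sfStep Lc j) (smStep d Lc j) (S j))
            (unitM (sfStep Lc j) (smStep d Lc j) (M j)) 0
            (unitM₂ (sfStep Lc j) (smStep d Lc j) (M2Of d Lc mixFF j))) κ u κ' u') + cB • vh₂S κ u κ' u') := by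
  obtain ⟨C, δ, C₀, C₁, hδ, hKj, h₀, hW⟩ := step_data_of_letters G S M cE₂ cB Tc hLc hG hS hM hBl hmix j
  exact unitS₂_T2RecOf_succ_eq_lin4_add G S M cE₂ cB Tc vh₂S mixFF hBff hBmm j hδ hKj h₀ hW

/-- NOT IN PRINT; OUR BOOKKEEPING ([folklore] `T2HybridCells.eq_transportB_add_sum_cell` on the class of bounded bi-tables).  **ROAD W3's END BINDER `hsplit` VERBATIM FOR THE
DRESSED SLOTTED TOWER, WITH THE UNDRESSED TRANSPORT AND THE SOURCES «dressed source + cell»**: for ANY second kernel family `K` decaying per level,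
`T̃_n = 𝒯^B(0,n) T̃_0 + Σ_{l<n} 𝒯^B(l+1, n−1−l) (b̃_l + (lin4 c₄ G̃_l Lc T̃_l − lin4 c₄ K̃_l Lc T̃_l))`.  Letters: (DG) for `G` and `K`, (LS), (LM), the border's off-diagonality
and shape, the mixed table. -/
theorem unitS₂_T2RecOf_eq_transportB_add_sum_cell_of_letters (hLc : 1 ≤ Lc)
    (hBff : ∀ κ u κ' u' x z (α β : Fin (d + 1)), vh₂S κ u κ' u' x z (Sum.inl α) (Sum.inl β) = 0)
    (hBmm : ∀ κ u κ' u' x z (μ ν : Fin (d + 1)), vh₂S κ u κ' u' x z (Sum.inr μ) (Sum.inr ν) = 0)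
    (hG : ∀ j : ℕ, ∃ δ C : ℝ, 0 < δ ∧ 0 ≤ C ∧ Decays (G j) C δ) (hK : ∀ j : ℕ, ∃ δ C : ℝ, 0 < δ ∧ 0 ≤ C ∧ Decays (K j) C δ)
    (hS : ∀ j : ℕ, ∃ Cs δ : ℝ, 0 < δ ∧ LocStencil (S j) Cs δ) (hM : ∀ j : ℕ, ∃ CM δ : ℝ, 0 < δ ∧ VertexFamily (M j) Lc CM δ)
    (hBl : ∃ C δ : ℝ, 0 < δ ∧ LocStencil₂ vh₂S C δ) (hmix : ∃ C δ : ℝ, 0 < δ ∧ LocStencilFM Lc mixFF C δ) (n : ℕ) :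
    (unitS₂ (sfStep Lc n) (smStep d Lc n) (T2RecOf d Lc G S M cE₂ cB Tc vh₂S mixFF n)) =
      transport (fun j => lin4 (cE₂ * (Lc : ℝ) ^ (2 * (d + 1))) (unitK (sfStep Lc j) (smStep d Lc j) (K j)) Lc) 0 n
          (unitS₂ (sfStep Lc 0) (smStep d Lc 0) (T2RecOf d Lc G S M cE₂ cB Tc vh₂S mixFF 0)) +
        ∑ l ∈ Finset.range n, transport (fun j => lin4 (cE₂ * (Lc : ℝ) ^ (2 * (d + 1))) (unitK (sfStep Lc j) (smStep d Lc j) (K j)) Lc) (l + 1) (n - 1 - l)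
          ((fun κ u κ' u' => (cE₂ * (Lc : ℝ) ^ (2 * (d + 1))) • mmRead Lc (K3OfK (unitK (sfStep Lc l) (smStep d Lc l) (G l)) Lc
            (unitS (sfStep Lc l) (smStep d Lc l) (S l)) (unitM (sfStep Lc l) (smStep d Lc l) (M l)) (W2SymOfK
            (unitK (sfStep Lc l) (smStep d Lc l) (G l)) Lc (unitS (sfStep Lc l) (smStep d Lc l) (S l))
            (unitM (sfStep Lc l) (smStep d Lc l) (M l)) 0
            (unitM₂ (sfStep Lc l) (smStep d Lc l) (M2Of d Lc mixFF l))) κ u κ' u') + cB • vh₂S κ u κ' u') +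
           (lin4 (cE₂ * (Lc : ℝ) ^ (2 * (d + 1))) (unitK (sfStep Lc l) (smStep d Lc l) (G l)) Lc
              (unitS₂ (sfStep Lc l) (smStep d Lc l) (T2RecOf d Lc G S M cE₂ cB Tc vh₂S mixFF l)) -
            lin4 (cE₂ * (Lc : ℝ) ^ (2 * (d + 1))) (unitK (sfStep Lc l) (smStep d Lc l) (K l)) Lc
              (unitS₂ (sfStep Lc l) (smStep d Lc l) (T2RecOf d Lc G S M cE₂ cB Tc vh₂S mixFF l)))) := by
  have hGu : ∀ j, ∃ C δ : ℝ, 0 < δ ∧ Decays (unitK (sfStep Lc j) (smStep d Lc j) (G j)) C δ := fun j => by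
    obtain ⟨δ, C, hδ, -, h⟩ := hG j
    exact ⟨_, δ, hδ, decays_unitK (sf := sfStep Lc j) (sm := smStep d Lc j) h⟩
  have hKu : ∀ j, ∃ C δ : ℝ, 0 < δ ∧ Decays (unitK (sfStep Lc j) (smStep d Lc j) (K j)) C δ := fun j => by
    obtain ⟨δ, C, hδ, -, h⟩ := hK j
    exact ⟨_, δ, hδ, decays_unitK (sf := sfStep Lc j) (sm := smStep d Lc j) h⟩
  have hrec := succ_eq_lin4_add_of_letters G S M cE₂ cB Tc hLc hBff hBmm hG hS hM hBl hmix
  have hb := fun j => bdd₄_source_of_letters G S M cE₂ cB vh₂S mixFF Tc hLc hBff hBmm hG hS hM hBl hmix j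
  refine eq_transportB_add_sum_cell (A := (fun j => lin4 (cE₂ * (Lc : ℝ) ^ (2 * (d + 1))) (unitK (sfStep Lc j) (smStep d Lc j) (G j)) Lc))
    (B := (fun j => lin4 (cE₂ * (Lc : ℝ) ^ (2 * (d + 1))) (unitK (sfStep Lc j) (smStep d Lc j) (K j)) Lc))
    (P := fun X => ∃ B : ℝ, ∀ κ u κ' u' x z a b, |X κ u κ' u' x z a b| ≤ B)
    (x := fun j => (unitS₂ (sfStep Lc j) (smStep d Lc j) (T2RecOf d Lc G S M cE₂ cB Tc vh₂S mixFF j)))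
    bdd₄_zero (fun _ _ => bdd₄_add) (fun _ _ => bdd₄_sub) (fun j Y hY => ?_) (fun j Y hY => ?_) (fun j Y Z hY hZ => ?_)
    (bdd₄_unitS₂_T2RecOf_of_letters G S M cE₂ cB Tc hLc hG hS hM hBl hmix 0) hb hrec n
  · obtain ⟨C, δ, hδ, h⟩ := hGu j
    exact lin4_bdd h hδ _ Lc hY
  · obtain ⟨C, δ, hδ, h⟩ := hKu j
    exact lin4_bdd h hδ _ Lc hY
  · obtain ⟨C, δ, hδ, h⟩ := hKu j
    exact lin4_add_of_bdd₄ h hδ _ Lc hY hZ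

/-- NOT IN PRINT; OUR BOOKKEEPING ([folklore] `T2HybridCells.eq_hyb_add_sum_transport_cell` on the class of bounded bi-tables).  **THE SLOTTED UNIT `T₂` TOWER = p2's HYBRID
CARRIER + THE LEVEL SUM OF UNDRESSED TRANSPORTS OF THE CELLS**, for ANY second kernel family `K` decaying per level:
`T̃_n = (𝒯^B(0,n) T̃_0 + Σ_{i<n} 𝒯^B(i+1,n−1−i) b̃_i) + Σ_{l<n} 𝒯^B(l+1,n−1−l) (lin4 c₄ G̃_l Lc T̃_l − lin4 c₄ K̃_l Lc T̃_l)`. -/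
theorem unitS₂_T2RecOf_eq_hyb_add_sum_transport_cell_of_letters (hLc : 1 ≤ Lc)
    (hBff : ∀ κ u κ' u' x z (α β : Fin (d + 1)), vh₂S κ u κ' u' x z (Sum.inl α) (Sum.inl β) = 0)
    (hBmm : ∀ κ u κ' u' x z (μ ν : Fin (d + 1)), vh₂S κ u κ' u' x z (Sum.inr μ) (Sum.inr ν) = 0)
    (hG : ∀ j : ℕ, ∃ δ C : ℝ, 0 < δ ∧ 0 ≤ C ∧ Decays (G j) C δ) (hK : ∀ j : ℕ, ∃ δ C : ℝ, 0 < δ ∧ 0 ≤ C ∧ Decays (K j) C δ)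
    (hS : ∀ j : ℕ, ∃ Cs δ : ℝ, 0 < δ ∧ LocStencil (S j) Cs δ) (hM : ∀ j : ℕ, ∃ CM δ : ℝ, 0 < δ ∧ VertexFamily (M j) Lc CM δ)
    (hBl : ∃ C δ : ℝ, 0 < δ ∧ LocStencil₂ vh₂S C δ) (hmix : ∃ C δ : ℝ, 0 < δ ∧ LocStencilFM Lc mixFF C δ) (n : ℕ) :
    (unitS₂ (sfStep Lc n) (smStep d Lc n) (T2RecOf d Lc G S M cE₂ cB Tc vh₂S mixFF n)) =
      (transport (fun j => lin4 (cE₂ * (Lc : ℝ) ^ (2 * (d + 1))) (unitK (sfStep Lc j) (smStep d Lc j) (K j)) Lc) 0 n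
          (unitS₂ (sfStep Lc 0) (smStep d Lc 0) (T2RecOf d Lc G S M cE₂ cB Tc vh₂S mixFF 0)) +
        ∑ i ∈ Finset.range n, transport (fun j => lin4 (cE₂ * (Lc : ℝ) ^ (2 * (d + 1))) (unitK (sfStep Lc j) (smStep d Lc j) (K j)) Lc) (i + 1) (n - 1 - i)
          (fun κ u κ' u' => (cE₂ * (Lc : ℝ) ^ (2 * (d + 1))) • mmRead Lc (K3OfK (unitK (sfStep Lc i) (smStep d Lc i) (G i)) Lc
            (unitS (sfStep Lc i) (smStep d Lc i) (S i)) (unitM (sfStep Lc i) (smStep d Lc i) (M i)) (W2SymOfK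
            (unitK (sfStep Lc i) (smStep d Lc i) (G i)) Lc (unitS (sfStep Lc i) (smStep d Lc i) (S i))
            (unitM (sfStep Lc i) (smStep d Lc i) (M i)) 0
            (unitM₂ (sfStep Lc i) (smStep d Lc i) (M2Of d Lc mixFF i))) κ u κ' u') + cB • vh₂S κ u κ' u')) +
      ∑ l ∈ Finset.range n, transport (fun j => lin4 (cE₂ * (Lc : ℝ) ^ (2 * (d + 1))) (unitK (sfStep Lc j) (smStep d Lc j) (K j)) Lc) (l + 1) (n - 1 - l)
          (lin4 (cE₂ * (Lc : ℝ) ^ (2 * (d + 1))) (unitK (sfStep Lc l) (smStep d Lc l) (G l)) Lc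
              (unitS₂ (sfStep Lc l) (smStep d Lc l) (T2RecOf d Lc G S M cE₂ cB Tc vh₂S mixFF l)) -
            lin4 (cE₂ * (Lc : ℝ) ^ (2 * (d + 1))) (unitK (sfStep Lc l) (smStep d Lc l) (K l)) Lc
              (unitS₂ (sfStep Lc l) (smStep d Lc l) (T2RecOf d Lc G S M cE₂ cB Tc vh₂S mixFF l))) := by
  have hGu : ∀ j, ∃ C δ : ℝ, 0 < δ ∧ Decays (unitK (sfStep Lc j) (smStep d Lc j) (G j)) C δ := fun j => by
    obtain ⟨δ, C, hδ, -, h⟩ := hG j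
    exact ⟨_, δ, hδ, decays_unitK (sf := sfStep Lc j) (sm := smStep d Lc j) h⟩
  have hKu : ∀ j, ∃ C δ : ℝ, 0 < δ ∧ Decays (unitK (sfStep Lc j) (smStep d Lc j) (K j)) C δ := fun j => by
    obtain ⟨δ, C, hδ, -, h⟩ := hK j
    exact ⟨_, δ, hδ, decays_unitK (sf := sfStep Lc j) (sm := smStep d Lc j) h⟩
  have hrec := succ_eq_lin4_add_of_letters G S M cE₂ cB Tc hLc hBff hBmm hG hS hM hBl hmix
  have hb := fun j => bdd₄_source_of_letters G S M cE₂ cB vh₂S mixFF Tc hLc hBff hBmm hG hS hM hBl hmix j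
  refine eq_hyb_add_sum_transport_cell (A := (fun j => lin4 (cE₂ * (Lc : ℝ) ^ (2 * (d + 1))) (unitK (sfStep Lc j) (smStep d Lc j) (G j)) Lc))
    (B := (fun j => lin4 (cE₂ * (Lc : ℝ) ^ (2 * (d + 1))) (unitK (sfStep Lc j) (smStep d Lc j) (K j)) Lc))
    (P := fun X => ∃ B : ℝ, ∀ κ u κ' u' x z a b, |X κ u κ' u' x z a b| ≤ B)
    (x := fun j => (unitS₂ (sfStep Lc j) (smStep d Lc j) (T2RecOf d Lc G S M cE₂ cB Tc vh₂S mixFF j)))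
    bdd₄_zero (fun _ _ => bdd₄_add) (fun _ _ => bdd₄_sub) (fun j Y hY => ?_) (fun j Y hY => ?_) (fun j Y Z hY hZ => ?_)
    (bdd₄_unitS₂_T2RecOf_of_letters G S M cE₂ cB Tc hLc hG hS hM hBl hmix 0) hb hrec n
  · obtain ⟨C, δ, hδ, h⟩ := hGu j
    exact lin4_bdd h hδ _ Lc hY
  · obtain ⟨C, δ, hδ, h⟩ := hKu j
    exact lin4_bdd h hδ _ Lc hY
  · obtain ⟨C, δ, hδ, h⟩ := hKu j
    exact lin4_add_of_bdd₄ h hδ _ Lc hY hZ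

end Slotted

/-! ## §4 The COMB data: letters discharged -/

section Comb

variable {Lc : ℕ} [NeZero Lc] {r : Fin (d + 1) → ℕ}

/-- NOT IN PRINT; OUR BOOKKEEPING (`unitS₂_T2RecOf_eq_transportB_add_sum_cell_of_letters` at the comb data through an2's bridge `T2RecOf_comb`; (DG) for the dressed kernels —
asym1's `decays_coDressKBmAt_KInvStep` — and for `KInvStep` — `decays_KInvStep` —, (LS) `locStencil_SpureRecAt`, (LM) `vertexFamily_M1At`, the mixed table `hmix_an1`
DISCHARGED).  **an2's COMB TOWER SATISFIES ROAD W3's END BINDER `hsplit` WITH THE TRANSPORT OF RECORD AND THE SOURCES «dressed source + dressing cell»** (any root in the block,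
any pins, any initial table, any off-diagonal `LocStencil₂` border) — so `WSlotT2OfPieces.shape_of_rows` ∕ `rate_of_rows` apply to the DRESSED tower AS THEY STAND, asking
the (F4)∕(F2) rows of the combined sources `b̃_l + cell_l`. -/
theorem unitS₂_T2RecAt_eq_transportB_add_sum_cell (hLc : 1 ≤ Lc) (hr : r ∈ box (d + 1) Lc) (cE cVH cΛ cE₂ cB : ℝ)
    (Tc : Fin 4 → Fin 4 → Fin 4 → Fin 4 → ℝ) {vh₂S : Fin (d + 1) → (Fin (d + 1) → ℤ) → Fin (d + 1) → (Fin (d + 1) → ℤ) → MKer (d + 1) (Fib d)}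
    (hBff : ∀ κ u κ' u' x z (α β : Fin (d + 1)), vh₂S κ u κ' u' x z (Sum.inl α) (Sum.inl β) = 0)
    (hBmm : ∀ κ u κ' u' x z (μ ν : Fin (d + 1)), vh₂S κ u κ' u' x z (Sum.inr μ) (Sum.inr ν) = 0)
    (hB : ∃ C δ : ℝ, 0 < δ ∧ LocStencil₂ vh₂S C δ) (n : ℕ) :
    (unitS₂ (sfStep Lc n) (smStep d Lc n) (T2RecAt d Lc (toSite r) cE cVH cΛ cE₂ cB Tc vh₂S (mixFFAt (toSite r) Lc) n)) =
      transport (fun j => lin4 (cE₂ * (Lc : ℝ) ^ (2 * (d + 1))) (unitK (sfStep Lc j) (smStep d Lc j) (KInvStep (d := d) Lc j)) Lc) 0 n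
          (unitS₂ (sfStep Lc 0) (smStep d Lc 0) (T2RecAt d Lc (toSite r) cE cVH cΛ cE₂ cB Tc vh₂S (mixFFAt (toSite r) Lc) 0)) +
        ∑ l ∈ Finset.range n, transport (fun j => lin4 (cE₂ * (Lc : ℝ) ^ (2 * (d + 1))) (unitK (sfStep Lc j) (smStep d Lc j) (KInvStep (d := d) Lc j)) Lc) (l + 1) (n - 1 - l)
          ((fun κ u κ' u' => (cE₂ * (Lc : ℝ) ^ (2 * (d + 1))) • mmRead Lc (K3OfK (unitK (sfStep Lc l) (smStep d Lc l) (coDressKBmAt (toSite r) Lc (KInvStep (d := d) Lc l))) Lc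
            (unitS (sfStep Lc l) (smStep d Lc l) (SpureRecAt d Lc (toSite r) cE cVH cΛ l)) (unitM (sfStep Lc l) (smStep d Lc l) (M1At d Lc (toSite r) cΛ l)) (W2SymOfK
            (unitK (sfStep Lc l) (smStep d Lc l) (coDressKBmAt (toSite r) Lc (KInvStep (d := d) Lc l))) Lc (unitS (sfStep Lc l) (smStep d Lc l) (SpureRecAt d Lc (toSite r) cE cVH cΛ l))
            (unitM (sfStep Lc l) (smStep d Lc l) (M1At d Lc (toSite r) cΛ l)) 0
            (unitM₂ (sfStep Lc l) (smStep d Lc l) (M2Of d Lc (mixFFAt (toSite r) Lc) l))) κ u κ' u') + cB • vh₂S κ u κ' u') +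
           (lin4 (cE₂ * (Lc : ℝ) ^ (2 * (d + 1))) (unitK (sfStep Lc l) (smStep d Lc l) (coDressKBmAt (toSite r) Lc (KInvStep (d := d) Lc l))) Lc
              (unitS₂ (sfStep Lc l) (smStep d Lc l) (T2RecAt d Lc (toSite r) cE cVH cΛ cE₂ cB Tc vh₂S (mixFFAt (toSite r) Lc) l)) -
            lin4 (cE₂ * (Lc : ℝ) ^ (2 * (d + 1))) (unitK (sfStep Lc l) (smStep d Lc l) (KInvStep (d := d) Lc l)) Lc
              (unitS₂ (sfStep Lc l) (smStep d Lc l) (T2RecAt d Lc (toSite r) cE cVH cΛ cE₂ cB Tc vh₂S (mixFFAt (toSite r) Lc) l)))) := by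
  have h := unitS₂_T2RecOf_eq_transportB_add_sum_cell_of_letters (fun j => coDressKBmAt (toSite r) Lc (KInvStep (d := d) Lc j)) (fun j => KInvStep (d := d) Lc j)
    (SpureRecAt d Lc (toSite r) cE cVH cΛ) (M1At d Lc (toSite r) cΛ) cE₂ cB Tc (vh₂S := vh₂S) (mixFF := mixFFAt (toSite r) Lc) hLc hBff hBmm
    (fun j => decays_coDressKBmAt_KInvStep (d := d) hr j) (fun j => decays_KInvStep (d := d) (Lc := Lc) j) (fun j => locStencil_SpureRecAt hLc hr cE cVH cΛ j)
    (fun j => ⟨_, 1, one_pos, vertexFamily_M1At hLc hr cΛ j zero_le_one⟩) hB (hmix_an1 hLc hr) n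
  simp only [T2RecOf_comb] at h
  exact h

/-- NOT IN PRINT; OUR BOOKKEEPING.  **an2's COMB TOWER = p2's HYBRID CARRIER (road W3's transport OF RECORD on the dressed sources) + THE LEVEL SUM OF UNDRESSED TRANSPORTS OF
THE DRESSING CELLS.** -/
theorem unitS₂_T2RecAt_eq_hyb_add_sum_transport_cell (hLc : 1 ≤ Lc) (hr : r ∈ box (d + 1) Lc) (cE cVH cΛ cE₂ cB : ℝ)
    (Tc : Fin 4 → Fin 4 → Fin 4 → Fin 4 → ℝ) {vh₂S : Fin (d + 1) → (Fin (d + 1) → ℤ) → Fin (d + 1) → (Fin (d + 1) → ℤ) → MKer (d + 1) (Fib d)}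
    (hBff : ∀ κ u κ' u' x z (α β : Fin (d + 1)), vh₂S κ u κ' u' x z (Sum.inl α) (Sum.inl β) = 0)
    (hBmm : ∀ κ u κ' u' x z (μ ν : Fin (d + 1)), vh₂S κ u κ' u' x z (Sum.inr μ) (Sum.inr ν) = 0)
    (hB : ∃ C δ : ℝ, 0 < δ ∧ LocStencil₂ vh₂S C δ) (n : ℕ) :
    (unitS₂ (sfStep Lc n) (smStep d Lc n) (T2RecAt d Lc (toSite r) cE cVH cΛ cE₂ cB Tc vh₂S (mixFFAt (toSite r) Lc) n)) =
      (transport (fun j => lin4 (cE₂ * (Lc : ℝ) ^ (2 * (d + 1))) (unitK (sfStep Lc j) (smStep d Lc j) (KInvStep (d := d) Lc j)) Lc) 0 n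
          (unitS₂ (sfStep Lc 0) (smStep d Lc 0) (T2RecAt d Lc (toSite r) cE cVH cΛ cE₂ cB Tc vh₂S (mixFFAt (toSite r) Lc) 0)) +
        ∑ i ∈ Finset.range n, transport (fun j => lin4 (cE₂ * (Lc : ℝ) ^ (2 * (d + 1))) (unitK (sfStep Lc j) (smStep d Lc j) (KInvStep (d := d) Lc j)) Lc) (i + 1) (n - 1 - i)
          (fun κ u κ' u' => (cE₂ * (Lc : ℝ) ^ (2 * (d + 1))) • mmRead Lc (K3OfK (unitK (sfStep Lc i) (smStep d Lc i) (coDressKBmAt (toSite r) Lc (KInvStep (d := d) Lc i))) Lc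
            (unitS (sfStep Lc i) (smStep d Lc i) (SpureRecAt d Lc (toSite r) cE cVH cΛ i)) (unitM (sfStep Lc i) (smStep d Lc i) (M1At d Lc (toSite r) cΛ i)) (W2SymOfK
            (unitK (sfStep Lc i) (smStep d Lc i) (coDressKBmAt (toSite r) Lc (KInvStep (d := d) Lc i))) Lc (unitS (sfStep Lc i) (smStep d Lc i) (SpureRecAt d Lc (toSite r) cE cVH cΛ i))
            (unitM (sfStep Lc i) (smStep d Lc i) (M1At d Lc (toSite r) cΛ i)) 0
            (unitM₂ (sfStep Lc i) (smStep d Lc i) (M2Of d Lc (mixFFAt (toSite r) Lc) i))) κ u κ' u') + cB • vh₂S κ u κ' u')) +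
      ∑ l ∈ Finset.range n, transport (fun j => lin4 (cE₂ * (Lc : ℝ) ^ (2 * (d + 1))) (unitK (sfStep Lc j) (smStep d Lc j) (KInvStep (d := d) Lc j)) Lc) (l + 1) (n - 1 - l)
          (lin4 (cE₂ * (Lc : ℝ) ^ (2 * (d + 1))) (unitK (sfStep Lc l) (smStep d Lc l) (coDressKBmAt (toSite r) Lc (KInvStep (d := d) Lc l))) Lc
              (unitS₂ (sfStep Lc l) (smStep d Lc l) (T2RecAt d Lc (toSite r) cE cVH cΛ cE₂ cB Tc vh₂S (mixFFAt (toSite r) Lc) l)) -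
            lin4 (cE₂ * (Lc : ℝ) ^ (2 * (d + 1))) (unitK (sfStep Lc l) (smStep d Lc l) (KInvStep (d := d) Lc l)) Lc
              (unitS₂ (sfStep Lc l) (smStep d Lc l) (T2RecAt d Lc (toSite r) cE cVH cΛ cE₂ cB Tc vh₂S (mixFFAt (toSite r) Lc) l))) := by
  have h := unitS₂_T2RecOf_eq_hyb_add_sum_transport_cell_of_letters (fun j => coDressKBmAt (toSite r) Lc (KInvStep (d := d) Lc j)) (fun j => KInvStep (d := d) Lc j)
    (SpureRecAt d Lc (toSite r) cE cVH cΛ) (M1At d Lc (toSite r) cΛ) cE₂ cB Tc (vh₂S := vh₂S) (mixFF := mixFFAt (toSite r) Lc) hLc hBff hBmm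
    (fun j => decays_coDressKBmAt_KInvStep (d := d) hr j) (fun j => decays_KInvStep (d := d) (Lc := Lc) j) (fun j => locStencil_SpureRecAt hLc hr cE cVH cΛ j)
    (fun j => ⟨_, 1, one_pos, vertexFamily_M1At hLc hr cΛ j zero_le_one⟩) hB (hmix_an1 hLc hr) n
  simp only [T2RecOf_comb] at h
  exact h

end Comb

end Summit.QuantumFields.BalabanUV.Beta.GAN24.T2HybridCellsComb

end
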